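import Summits.NavierStokesRegularity.FluidComputer.GateBudgetClockBand
import Summits.NavierStokesRegularity.FluidComputer.GateBudgetCarrierPhase
import HarnessLib

/-!
# GateBudget part 74 — the leak ceiling of one pulse, I: climb and fall laws (§224–§225)

Cell `pub-fluidc`, blueprint seat bp1 (gen 36, third item, file 2 of 4); namespace
`Summit.NavierStokesRegularity.FluidComputer.GateBudget`, headline family
`RotorKnob.rotorCircuit K K¹⁰ ε ρ` from `delayInit`, lattice `ε = kK¹⁰ρ²`. HONEST FRAMING:
a low prior, high value-of-information experiment on Tao's machine paradigm; NOT a claim that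
NS blows up.

THE POINT. Part 71 §217 bounds the pulse leak from BELOW (`Δã ≥ 1/K⁹` at a clean rung,
part 72); parts 52/63 and 65–67 bound it from ABOVE only through `d² ≤ 1` (`Δã ≤ K(T' - r)`,
i.e. `≤ 242/K⁸`, resp. `≤ 241 log K/K⁹`). Parts 74/75 prove the phase-resolved CEILING. The
key structure: on the lattice `kμ = kK¹⁰/ε = 1/ρ²` EXACTLY (`μ = K¹⁰/ε`), so the dose phase
`Φ' = c/ρ² = kμc` is `k` times the pump action — while the clock is charged (`b ≥ β`) the
phase is slaved to the trigger, `0 ≤ Φ ≤ k(c - c(r))/β` (§224), and after the swing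
(`b ≤ -β'`) the remaining phase is `0 ≤ Φ(T') - Φ ≤ kc/β' + kσ(T' - r)/β'` (§225). Hence, in
the co-rotating frame of part 14 §43 (`d = S + O(L(t - r))`, `S = sin Φ·a(r) + cos Φ·d(r)`):
* §224 `leak_climb` (CLIMB, `b ≥ β` on `[r, t₁]`): `S² ≤ 2Φ² + 2d(r)² ≤ 2k²c²/β² + 2d(r)²`
  and `μβc² ≤ cc'` (exponential growth), so `ã - κc² - (2Kd(r)² + 6KL(T' - r))t` is
  non-increasing, `κ = Kk²ε/(K¹⁰β³)`:
  `ã(t₁) - ã(r) ≤ κ(c(t₁)² - c(r)²) + 2Kd(r)²(t₁ - r) + 6KL(T' - r)(t₁ - r)`.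
* §225 `leak_fall` (FALL, `b ≤ -β'` on `[t₂, T']`, exit pin `|Φ(T') - kπ| ≤ δ`):
  `S² ≤ 2d(r)² + 6δ² + 6ξ² + 6k²c²/β'²` and `μβ'c² ≤ 2σε - cc'` (exponential decay,
  `σ = ρ²e^{-K¹⁰}`), so with `κ' = Kk²ε/(K¹⁰β'³)`:
  `ã(T') - ã(t₂) ≤ 3κ'c(t₂)² + (K(2d(r)² + 6δ² + 6ξ²) + 12κ'σε + 6KL(T' - r))(T' - t₂)`.
Part 75 assembles these with part 73 §223's phases into the pulse ceiling, part 76 into the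
two-sided rung. HONEST LIMITS. (i) `sin² Φ ≤ Φ²` on the whole climb costs `k²` where the truth is
`O(log k)` — fine for the small-`k` members the headline quotes, weak for long pulses; (ii) the
drift is spent at the uniform `6L(T' - r)` of part 14 §43; (iii) the laws need only `K ≥ 0`,
`ε, ρ > 0` and the lattice; (iv) nothing about Navier–Stokes.
[cite: Tao2016AveragedNS, §5.5 Theorem 5.3, (5.5), (b-eq), (c-eq), (d-eq), (energy-con)]
-/

noncomputable section
namespace Summit.NavierStokesRegularity.FluidComputer.GateBudget
open Real Set Filter Topology
open Literature.Analysis.FluidPDE.Tao2016AveragedNS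

variable {K ε ρ : ℝ} {X : ℝ → Fin 5 → ℝ} {C : ℝ → ℝ}
/-! ## §224 The climb: output while the clock is charged -/

/-- The lattice identity: on `ε = kK¹⁰ρ²` (`ε > 0`, `K ≥ 0`) one has `k ≥ 1`, `K¹⁰ > 0` and
`k·μ = 1/ρ²` for the pump rate `μ = K¹⁰/ε` — the dose phase `c/ρ²` is `k` times the pump
action `μc`. [derived: arithmetic] -/
theorem lattice_phase_unit {k : ℕ} {μ : ℝ} (hK : 0 ≤ K) (hε : 0 < ε)
    (hk : ε = k * K ^ 10 * ρ ^ 2) (hμ : μ = ε⁻¹ * K ^ 10) :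
    (0 : ℝ) < k ∧ 0 < K ^ 10 ∧ (k : ℝ) * μ = (ρ ^ 2)⁻¹ := by
  have hk1 : 1 ≤ k := by
    rcases Nat.eq_zero_or_pos k with rfl | h
    · simp at hk; exact absurd hk hε.ne'
    · exact h
  have hk0 : (0 : ℝ) < k := by exact_mod_cast hk1
  have hKne : K ≠ 0 := by rintro rfl; simp at hk; exact hε.ne' hk
  have hK10 : (0 : ℝ) < K ^ 10 := lt_of_le_of_ne (pow_nonneg hK 10) (pow_ne_zero 10 hKne).symm
  have hρ : ρ ≠ 0 := by rintro rfl; simp at hk; exact hε.ne' hk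
  refine ⟨hk0, hK10, ?_⟩
  rw [hμ, hk]; field_simp

/-- The co-rotating bound of part 14 §43 in the form used below: on `r ≤ u ≤ T'` (`r ≥ 0`),
`d(u)² ≤ S(u)² + 6L(T' - r)` with `S = sin Φ·a(r) + cos Φ·d(r)`, `Φ = (C(u) - C(r))/ρ²`,
`L = ε + ρ²e^{-K¹⁰} + Kã(T')`. [derived: part 14 §43 `knob_phase_tracking_d`] -/
theorem transfer_sq_le_corot
    (hX : ∀ t, HasDerivAt X (RotorKnob.rotorCircuit K (K ^ 10) ε ρ (X t)) t)
    (h0 : X 0 = delayInit) (hC : ∀ t, HasDerivAt C (X t 2) t) (hK : 0 ≤ K) (hε : 0 ≤ ε)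
    {r u T' : ℝ} (hr : 0 ≤ r) (hru : r ≤ u) (huT : u ≤ T') :
    X u 3 ^ 2 ≤ (sin ((C u - C r) / ρ ^ 2) * X r 0 + cos ((C u - C r) / ρ ^ 2) * X r 3) ^ 2
      + 6 * (ε + ρ ^ 2 * exp (-K ^ 10) + K * X T' 4) * (T' - r) := by
  obtain ⟨S, hS⟩ : ∃ S : ℝ, S = sin ((C u - C r) / ρ ^ 2) * X r 0
    + cos ((C u - C r) / ρ ^ 2) * X r 3 := ⟨_, rfl⟩
  obtain ⟨L, hL⟩ : ∃ L : ℝ, L = ε + ρ ^ 2 * exp (-K ^ 10) + K * X T' 4 := ⟨_, rfl⟩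
  rw [← hS, ← hL]
  have htr := knob_phase_tracking_d hX h0 hC hε hK hr hru
  rw [← hS] at htr
  have hL0 : 0 ≤ L := by
    rw [hL]; have := RotorKnob.e_nonneg hX h0 hK (hr.trans (hru.trans huT)); positivity
  have hmono : X u 4 ≤ X T' 4 := RotorKnob.rotorCircuit_output_monotone hK hX huT
  have hLu : ε + ρ ^ 2 * exp (-K ^ 10) + K * X u 4 ≤ L := by
    rw [hL]; linarith only [mul_le_mul_of_nonneg_left hmono hK]
  have hdS : |X u 3 - S| ≤ 2 * (L * (T' - r)) := by
    refine htr.trans ?_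
    have h1 : (ε + ρ ^ 2 * exp (-K ^ 10) + K * X u 4) * (u - r) ≤ L * (u - r) :=
      mul_le_mul_of_nonneg_right hLu (by linarith only [hru])
    have h2 : L * (u - r) ≤ L * (T' - r) := mul_le_mul_of_nonneg_left (by linarith) hL0
    linarith only [h1, h2]
  have hsum : |X u 3 + S| ≤ 3 := by
    have hd1 := RotorKnob.traj_abs_le_one hX h0 u 3
    have ha0 := RotorKnob.traj_abs_le_one hX h0 r 0
    have hd0 := RotorKnob.traj_abs_le_one hX h0 r 3
    have hS2 : |S| ≤ 2 := by
      rw [hS]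
      refine (abs_add_le _ _).trans ?_
      rw [abs_mul, abs_mul]
      have e1 : |sin ((C u - C r) / ρ ^ 2)| * |X r 0| ≤ 1 * 1 :=
        mul_le_mul (abs_sin_le_one _) ha0 (abs_nonneg _) zero_le_one
      have e2 : |cos ((C u - C r) / ρ ^ 2)| * |X r 3| ≤ 1 * 1 :=
        mul_le_mul (abs_cos_le_one _) hd0 (abs_nonneg _) zero_le_one
      linarith only [e1, e2]
    exact (abs_add_le _ _).trans (by linarith only [hd1, hS2])
  have hprod : |(X u 3 - S) * (X u 3 + S)| ≤ 2 * (L * (T' - r)) * 3 := by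
    rw [abs_mul]
    exact mul_le_mul hdS hsum (abs_nonneg _) (mul_nonneg zero_le_two (mul_nonneg hL0 (by linarith)))
  have hsq : X u 3 ^ 2 - S ^ 2 = (X u 3 - S) * (X u 3 + S) := by ring
  linarith only [hprod, le_abs_self ((X u 3 - S) * (X u 3 + S)), hsq]

/-- The transfer function is small near phase `0`: `S² ≤ 2Φ² + 2d(r)²` (`|sin Φ| ≤ |Φ|`,
`|a(r)|, |cos Φ| ≤ 1`). [derived: RotorKnob (est)] -/
theorem corot_sq_le_phase
    (hX : ∀ t, HasDerivAt X (RotorKnob.rotorCircuit K (K ^ 10) ε ρ (X t)) t)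
    (h0 : X 0 = delayInit) (r φ : ℝ) :
    (sin φ * X r 0 + cos φ * X r 3) ^ 2 ≤ 2 * φ ^ 2 + 2 * X r 3 ^ 2 := by
  have ha0 := RotorKnob.traj_abs_le_one hX h0 r 0
  have h1 : |sin φ * X r 0| ≤ |φ| := by
    rw [abs_mul]
    calc |sin φ| * |X r 0| ≤ |φ| * 1 :=
          mul_le_mul (abs_sin_le_abs (x := φ)) ha0 (abs_nonneg _) (abs_nonneg _)
      _ = |φ| := mul_one _
  have h2 : |cos φ * X r 3| ≤ |X r 3| := by
    rw [abs_mul]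
    calc |cos φ| * |X r 3| ≤ 1 * |X r 3| :=
          mul_le_mul_of_nonneg_right (abs_cos_le_one _) (abs_nonneg _)
      _ = |X r 3| := one_mul _
  have h3 : |sin φ * X r 0 + cos φ * X r 3| ≤ |φ| + |X r 3| :=
    (abs_add_le _ _).trans (add_le_add h1 h2)
  have h4 : (sin φ * X r 0 + cos φ * X r 3) ^ 2 ≤ (|φ| + |X r 3|) ^ 2 := by
    rw [← sq_abs (sin φ * X r 0 + cos φ * X r 3)]
    exact pow_le_pow_left₀ (abs_nonneg _) h3 2
  have h5 : (|φ| + |X r 3|) ^ 2 ≤ 2 * |φ| ^ 2 + 2 * |X r 3| ^ 2 := by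
    nlinarith only [sq_nonneg (|φ| - |X r 3|)]
  rw [sq_abs, sq_abs] at h5
  exact h4.trans h5

/-- §224 THE CLIMB LAW (headline member, lattice `ε = kK¹⁰ρ²`, `K ≥ 0`, `ε > 0`). On
`[r, t₁] ⊆ [r, T']` (`r ≥ 0`) with the clock charged, `b ≥ β > 0`:
`ã(t₁) - ã(r) ≤ κ(c(t₁)² - c(r)²) + 2Kd(r)²(t₁ - r) + 6KL(T' - r)(t₁ - r)`, `κ = Kk²ε/(K¹⁰β³)`.
Mechanism: the phase is slaved to the trigger, `0 ≤ Φ ≤ k(c - c(r))/β` (`kμ = 1/ρ²`,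
`c' ≥ μβc`), so `S² ≤ 2k²c²/β² + 2d(r)²` with `K·2k²c²/β² ≤ 2κcc'`, and
`ã - κc² - (2Kd(r)² + 6KL(T' - r))t` is non-increasing. [derived: part 14 §43; this file] -/
theorem leak_climb
    (hX : ∀ t, HasDerivAt X (RotorKnob.rotorCircuit K (K ^ 10) ε ρ (X t)) t)
    (h0 : X 0 = delayInit) (hC : ∀ t, HasDerivAt C (X t 2) t) (hK : 0 ≤ K) (hε : 0 < ε)
    (k : ℕ) (hk : ε = k * K ^ 10 * ρ ^ 2) {r t₁ T' β : ℝ} (hr : 0 ≤ r)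
    (hrt : r ≤ t₁) (htT : t₁ ≤ T') (hβ : 0 < β) (hb : ∀ u ∈ Icc r t₁, β ≤ X u 1) :
    X t₁ 4 - X r 4 ≤ K * k ^ 2 * ε / (K ^ 10 * β ^ 3) * (X t₁ 2 ^ 2 - X r 2 ^ 2)
      + 2 * K * X r 3 ^ 2 * (t₁ - r)
      + 6 * K * (ε + ρ ^ 2 * exp (-K ^ 10) + K * X T' 4) * (T' - r) * (t₁ - r) := by
  obtain ⟨L, hL⟩ : ∃ L : ℝ, L = ε + ρ ^ 2 * exp (-K ^ 10) + K * X T' 4 := ⟨_, rfl⟩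
  obtain ⟨κ, hκ⟩ : ∃ κ : ℝ, κ = K * k ^ 2 * ε / (K ^ 10 * β ^ 3) := ⟨_, rfl⟩
  obtain ⟨μ, hμ⟩ : ∃ μ : ℝ, μ = ε⁻¹ * K ^ 10 := ⟨_, rfl⟩
  obtain ⟨σ, hσ⟩ : ∃ σ : ℝ, σ = ρ ^ 2 * exp (-K ^ 10) := ⟨_, rfl⟩
  rw [← hL, ← hκ]
  have hσ0 : 0 ≤ σ := by rw [hσ]; positivity
  have hc0 : ∀ u ∈ Icc r t₁, 0 ≤ X u 2 := fun u hu => RotorKnob.c_nonneg hX h0 (hr.trans hu.1)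
  obtain ⟨hk0, hK10, hkμ⟩ := lattice_phase_unit hK hε hk hμ
  have hμ0 : 0 < μ := by rw [hμ]; positivity
  have hκ0 : 0 ≤ κ := by
    rw [hκ]
    exact div_nonneg (mul_nonneg (mul_nonneg hK (sq_nonneg _)) hε.le)
      (mul_nonneg hK10.le (pow_nonneg hβ.le 3))
  -- the dose phase and its sign
  have hΦd : ∀ u, HasDerivAt (fun s => (C s - C r) / ρ ^ 2) (X u 2 / ρ ^ 2) u := fun u =>
    ((hC u).sub_const (C r)).div_const (ρ ^ 2)
  have hCmono := Thm53.monotoneOn_sub_of_le_deriv (f := C) (f' := fun u => X u 2)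
    (Φ := fun _ => (0 : ℝ)) (φ := fun _ => 0) (convex_Icc r t₁) (fun u _ => hC u)
    (fun u _ => hasDerivAt_const u 0) (fun u hu => hc0 u hu)
  have hΦ0 : ∀ u ∈ Icc r t₁, 0 ≤ (C u - C r) / ρ ^ 2 := by
    intro u hu
    have h := hCmono (left_mem_Icc.2 hrt) hu hu.1
    dsimp only at h
    exact div_nonneg (by linarith only [h]) (sq_nonneg ρ)
  -- the phase is slaved to the trigger: `k c/β - Φ` is non-decreasing
  have hV := Thm53.monotoneOn_sub_of_le_deriv (f := fun u => k * X u 2 / β)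
    (f' := fun u => k * (ρ ^ 2 * exp (-K ^ 10) * X u 0 ^ 2 + ε⁻¹ * K ^ 10 * X u 1 * X u 2) / β)
    (Φ := fun u => (C u - C r) / ρ ^ 2) (φ := fun u => X u 2 / ρ ^ 2) (convex_Icc r t₁)
    (fun u _ => ((RotorKnob.hasDerivAt_c hX u).const_mul (k : ℝ)).div_const β)
    (fun u _ => hΦd u)
    (fun u hu => by
      have hcu := hc0 u hu
      show X u 2 / ρ ^ 2
          ≤ k * (ρ ^ 2 * exp (-K ^ 10) * X u 0 ^ 2 + ε⁻¹ * K ^ 10 * X u 1 * X u 2) / β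
      rw [div_eq_mul_inv (X u 2), ← hkμ, ← hσ, ← hμ, le_div_iff₀ hβ]
      have h1 : 0 ≤ k * (σ * X u 0 ^ 2) := by positivity
      have h2 : β * X u 2 ≤ X u 1 * X u 2 := mul_le_mul_of_nonneg_right (hb u hu) hcu
      have h3 := mul_le_mul_of_nonneg_left h2 (by positivity : (0 : ℝ) ≤ k * μ)
      nlinarith only [h1, h3])
  have hΦle : ∀ u ∈ Icc r t₁, (C u - C r) / ρ ^ 2 ≤ k * X u 2 / β := by
    intro u hu
    have h := hV (left_mem_Icc.2 hrt) hu hu.1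
    dsimp only at h
    rw [sub_self, zero_div, sub_zero] at h
    have : 0 ≤ k * X r 2 / β :=
      div_nonneg (mul_nonneg k.cast_nonneg (hc0 r (left_mem_Icc.2 hrt))) hβ.le
    linarith only [h, this]
  -- the comparison function `ã - κc² - m t`
  obtain ⟨m, hm⟩ : ∃ m : ℝ, m = 2 * K * X r 3 ^ 2 + 6 * K * L * (T' - r) := ⟨_, rfl⟩
  have hanti := Thm53.antitoneOn_sub_of_deriv_le
    (f := fun u => X u 4 - κ * (X u 2 * X u 2))
    (f' := fun u => K * X u 3 ^ 2 - κ *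
      ((ρ ^ 2 * exp (-K ^ 10) * X u 0 ^ 2 + ε⁻¹ * K ^ 10 * X u 1 * X u 2) * X u 2
        + X u 2 * (ρ ^ 2 * exp (-K ^ 10) * X u 0 ^ 2 + ε⁻¹ * K ^ 10 * X u 1 * X u 2)))
    (Φ := fun u => m * u) (φ := fun _ => m) (convex_Icc r t₁)
    (fun u _ => (RotorKnob.hasDerivAt_e hX u).sub
      (((RotorKnob.hasDerivAt_c hX u).mul (RotorKnob.hasDerivAt_c hX u)).const_mul κ))
    (fun u _ => by simpa using (hasDerivAt_id' u).const_mul m)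
    (fun u hu => by
      have hcu := hc0 u hu
      set c' : ℝ := ρ ^ 2 * exp (-K ^ 10) * X u 0 ^ 2 + ε⁻¹ * K ^ 10 * X u 1 * X u 2 with hc'
      -- (a) co-rotating frame and (b) small phase
      have hd2 := transfer_sq_le_corot hX h0 hC hK hε.le hr hu.1 (hu.2.trans htT)
      rw [← hL] at hd2
      have hS2 := corot_sq_le_phase hX h0 r ((C u - C r) / ρ ^ 2)
      -- (c) `Φ² ≤ k²c²/β²`
      have hΦ2 : ((C u - C r) / ρ ^ 2) ^ 2 ≤ (k * X u 2 / β) ^ 2 :=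
        pow_le_pow_left₀ (hΦ0 u hu) (hΦle u hu) 2
      -- (d) exponential growth `μβc² ≤ cc'`
      have hgrow : μ * β * (X u 2 * X u 2) ≤ X u 2 * c' := by
        rw [hc', ← hσ, ← hμ]
        have h1 : 0 ≤ σ * X u 0 ^ 2 := by positivity
        have h2 : β * X u 2 ≤ X u 1 * X u 2 := mul_le_mul_of_nonneg_right (hb u hu) hcu
        have h3 := mul_le_mul_of_nonneg_left h2 (mul_nonneg hμ0.le hcu)
        nlinarith only [h1, h3, hcu]
      -- (e) `K k²c²/β² ≤ κ cc'`
      have hcore : K * (k * X u 2 / β) ^ 2 ≤ κ * (X u 2 * c') := by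
        have e1 : K * (k * X u 2 / β) ^ 2 = κ * (μ * β * (X u 2 * X u 2)) := by
          rw [hκ, hμ]; field_simp
        rw [e1]
        exact mul_le_mul_of_nonneg_left hgrow hκ0
      rw [hm]
      have e2 : κ * (c' * X u 2 + X u 2 * c') = 2 * (κ * (X u 2 * c')) := by ring
      rw [e2]
      nlinarith only [hd2, hS2, hΦ2, hcore, hK])
  have h := hanti (left_mem_Icc.2 hrt) (right_mem_Icc.2 hrt) hrt
  dsimp only at h
  have e : m * t₁ = m * r + (2 * K * X r 3 ^ 2 * (t₁ - r) + 6 * K * L * (T' - r) * (t₁ - r)) := by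
    rw [hm]; ring
  rw [sq (X t₁ 2), sq (X r 2)]
  linarith only [h, e]

/-! ## §225 The fall: output after the swing -/

/-- §225 THE FALL LAW (headline member, lattice `ε = kK¹⁰ρ²`, `K ≥ 0`, `ε > 0`). On
`[t₂, T']` (`0 ≤ r ≤ t₂`) with the clock reversed, `b ≤ -β' < 0`, the trigger at most `2ε`,
and the exit phase pinned, `|Φ(T') - kπ| ≤ δ`:
`ã(T') - ã(t₂) ≤ 3κ'c(t₂)² + (K(2d(r)² + 6δ² + 6ξ²) + 12κ'σε + 6KL(T' - r))(T' - t₂)`,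
`κ' = Kk²ε/(K¹⁰β'³)`, `σ = ρ²e^{-K¹⁰}`, `ξ = kσ(T' - r)/β'`. Mechanism: after the swing the
remaining phase is slaved to the trigger, `0 ≤ Φ(T') - Φ ≤ k(c - c(T'))/β' + ξ`
(`kμ = 1/ρ²`, `c' ≤ σ - μβ'c`), so `S² ≤ 2d(r)² + 6δ² + 6ξ² + 6k²c²/β'²` with
`K·6k²c²/β'² ≤ 6κ'(σc - cc')`, and `ã + 3κ'c² - (…)t` is non-increasing.
[derived: part 14 §43; this file] -/
theorem leak_fall
    (hX : ∀ t, HasDerivAt X (RotorKnob.rotorCircuit K (K ^ 10) ε ρ (X t)) t)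
    (h0 : X 0 = delayInit) (hC : ∀ t, HasDerivAt C (X t 2) t) (hK : 0 ≤ K) (hε : 0 < ε)
    (k : ℕ) (hk : ε = k * K ^ 10 * ρ ^ 2) {r t₂ T' β' δ : ℝ} (hr : 0 ≤ r)
    (hrt : r ≤ t₂) (htT : t₂ ≤ T') (hβ : 0 < β') (hb : ∀ u ∈ Icc t₂ T', X u 1 ≤ -β')
    (hc2 : ∀ u ∈ Icc t₂ T', X u 2 ≤ 2 * ε)
    (hpin : |(C T' - C r) / ρ ^ 2 - k * π| ≤ δ) :
    X T' 4 - X t₂ 4 ≤ 3 * (K * k ^ 2 * ε / (K ^ 10 * β' ^ 3)) * X t₂ 2 ^ 2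
      + (K * (2 * X r 3 ^ 2 + 6 * δ ^ 2
          + 6 * (k * (ρ ^ 2 * exp (-K ^ 10)) * (T' - r) / β') ^ 2)
        + 12 * (K * k ^ 2 * ε / (K ^ 10 * β' ^ 3)) * (ρ ^ 2 * exp (-K ^ 10)) * ε
        + 6 * K * (ε + ρ ^ 2 * exp (-K ^ 10) + K * X T' 4) * (T' - r)) * (T' - t₂) := by
  obtain ⟨L, hL⟩ : ∃ L : ℝ, L = ε + ρ ^ 2 * exp (-K ^ 10) + K * X T' 4 := ⟨_, rfl⟩
  obtain ⟨κ, hκ⟩ : ∃ κ : ℝ, κ = K * k ^ 2 * ε / (K ^ 10 * β' ^ 3) := ⟨_, rfl⟩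
  obtain ⟨μ, hμ⟩ : ∃ μ : ℝ, μ = ε⁻¹ * K ^ 10 := ⟨_, rfl⟩
  obtain ⟨σ, hσ⟩ : ∃ σ : ℝ, σ = ρ ^ 2 * exp (-K ^ 10) := ⟨_, rfl⟩
  obtain ⟨ξ, hξ⟩ : ∃ ξ : ℝ, ξ = k * σ * (T' - r) / β' := ⟨_, rfl⟩
  rw [← hL, ← hκ, ← hσ, ← hξ]
  have hσ0 : 0 ≤ σ := by rw [hσ]; positivity
  have ht₂0 : 0 ≤ t₂ := hr.trans hrt
  have hc0 : ∀ u ∈ Icc t₂ T', 0 ≤ X u 2 := fun u hu => RotorKnob.c_nonneg hX h0 (ht₂0.trans hu.1)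
  obtain ⟨hk0, hK10, hkμ⟩ := lattice_phase_unit hK hε hk hμ
  have hμ0 : 0 < μ := by rw [hμ]; positivity
  have hξ0 : 0 ≤ ξ := by
    rw [hξ]
    exact div_nonneg (mul_nonneg (mul_nonneg k.cast_nonneg hσ0) (by linarith)) hβ.le
  have hκ0 : 0 ≤ κ := by
    rw [hκ]
    exact div_nonneg (mul_nonneg (mul_nonneg hK (sq_nonneg _)) hε.le)
      (mul_nonneg hK10.le (pow_nonneg hβ.le 3))
  -- the dose phase: non-decreasing, and the remaining phase slaved to the trigger
  have hΦd : ∀ u, HasDerivAt (fun s => (C s - C r) / ρ ^ 2) (X u 2 / ρ ^ 2) u := fun u =>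
    ((hC u).sub_const (C r)).div_const (ρ ^ 2)
  have hCmono := Thm53.monotoneOn_sub_of_le_deriv (f := C) (f' := fun u => X u 2)
    (Φ := fun _ => (0 : ℝ)) (φ := fun _ => 0) (convex_Icc t₂ T') (fun u _ => hC u)
    (fun u _ => hasDerivAt_const u 0) (fun u hu => hc0 u hu)
  -- `Φ + k c/β' - (kσ/β') t` is non-increasing
  have hV := Thm53.antitoneOn_sub_of_deriv_le
    (f := fun u => (C u - C r) / ρ ^ 2 + k * X u 2 / β')
    (f' := fun u => X u 2 / ρ ^ 2
      + k * (ρ ^ 2 * exp (-K ^ 10) * X u 0 ^ 2 + ε⁻¹ * K ^ 10 * X u 1 * X u 2) / β')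
    (Φ := fun u => k * σ / β' * u) (φ := fun _ => k * σ / β') (convex_Icc t₂ T')
    (fun u _ => (hΦd u).add (((RotorKnob.hasDerivAt_c hX u).const_mul (k : ℝ)).div_const β'))
    (fun u _ => by simpa using (hasDerivAt_id' u).const_mul (k * σ / β'))
    (fun u hu => by
      have hcu := hc0 u hu
      have ha := RotorKnob.traj_sq_le_one hX h0 u 0
      show X u 2 / ρ ^ 2
          + k * (ρ ^ 2 * exp (-K ^ 10) * X u 0 ^ 2 + ε⁻¹ * K ^ 10 * X u 1 * X u 2) / β'
        ≤ k * σ / β'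
      rw [div_eq_mul_inv (X u 2), ← hkμ, ← hσ, ← hμ]
      have e : X u 2 * (k * μ) + k * (σ * X u 0 ^ 2 + μ * X u 1 * X u 2) / β'
          = (X u 2 * (k * μ) * β' + k * (σ * X u 0 ^ 2 + μ * X u 1 * X u 2)) / β' := by
        rw [add_div, mul_div_cancel_right₀ _ hβ.ne']
      rw [e, div_le_div_iff_of_pos_right hβ]
      have h1 : σ * X u 0 ^ 2 ≤ σ * 1 := mul_le_mul_of_nonneg_left ha hσ0
      have h2 : X u 1 * X u 2 ≤ -β' * X u 2 := mul_le_mul_of_nonneg_right (hb u hu) hcu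
      have h3 := mul_le_mul_of_nonneg_left h2 (by positivity : (0 : ℝ) ≤ k * μ)
      have h4 := mul_le_mul_of_nonneg_left h1 hk0.le
      nlinarith only [h3, h4, hcu, hβ, hk0, hμ0])
  have hrem : ∀ u ∈ Icc t₂ T', 0 ≤ (C T' - C r) / ρ ^ 2 - (C u - C r) / ρ ^ 2 ∧
      (C T' - C r) / ρ ^ 2 - (C u - C r) / ρ ^ 2 ≤ k * X u 2 / β' + ξ := by
    intro u hu
    have h1 := hCmono hu (right_mem_Icc.2 htT) hu.2
    have h2 := hV hu (right_mem_Icc.2 htT) hu.2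
    dsimp only at h1 h2
    constructor
    · rw [← sub_div]
      exact div_nonneg (by linarith only [h1]) (sq_nonneg ρ)
    · have hcT := hc0 T' (right_mem_Icc.2 htT)
      have e1 : k * σ / β' * T' - k * σ / β' * u = k * σ / β' * (T' - u) := by ring
      have e2 : k * σ / β' * (T' - u) ≤ ξ := by
        have hle : T' - u ≤ T' - r := by linarith only [hu.1, hrt]
        calc k * σ / β' * (T' - u) ≤ k * σ / β' * (T' - r) :=
              mul_le_mul_of_nonneg_left hle (div_nonneg (mul_nonneg k.cast_nonneg hσ0) hβ.le)
          _ = ξ := by rw [hξ]; ring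
      have e3 : 0 ≤ k * X T' 2 / β' := div_nonneg (mul_nonneg k.cast_nonneg hcT) hβ.le
      linarith only [h2, e1, e2, e3]
  -- the comparison function `ã + 3κc² - m t`
  obtain ⟨m, hm⟩ : ∃ m : ℝ, m = K * (2 * X r 3 ^ 2 + 6 * δ ^ 2 + 6 * ξ ^ 2) + 12 * κ * σ * ε
    + 6 * K * L * (T' - r) := ⟨_, rfl⟩
  have hanti := Thm53.antitoneOn_sub_of_deriv_le
    (f := fun u => X u 4 + 3 * κ * (X u 2 * X u 2))
    (f' := fun u => K * X u 3 ^ 2 + 3 * κ *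
      ((ρ ^ 2 * exp (-K ^ 10) * X u 0 ^ 2 + ε⁻¹ * K ^ 10 * X u 1 * X u 2) * X u 2
        + X u 2 * (ρ ^ 2 * exp (-K ^ 10) * X u 0 ^ 2 + ε⁻¹ * K ^ 10 * X u 1 * X u 2)))
    (Φ := fun u => m * u) (φ := fun _ => m) (convex_Icc t₂ T')
    (fun u _ => (RotorKnob.hasDerivAt_e hX u).add
      (((RotorKnob.hasDerivAt_c hX u).mul (RotorKnob.hasDerivAt_c hX u)).const_mul (3 * κ)))
    (fun u _ => by simpa using (hasDerivAt_id' u).const_mul m)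
    (fun u hu => by
      have hcu := hc0 u hu
      have ha := RotorKnob.traj_sq_le_one hX h0 u 0
      set c' : ℝ := ρ ^ 2 * exp (-K ^ 10) * X u 0 ^ 2 + ε⁻¹ * K ^ 10 * X u 1 * X u 2 with hc'
      -- (a) co-rotating frame
      have hd2 := transfer_sq_le_corot hX h0 hC hK hε.le hr (hrt.trans hu.1) hu.2
      rw [← hL] at hd2
      -- (b) the transfer function near phase `kπ`: `S² ≤ 2(Φ - kπ)² + 2d(r)²`
      obtain ⟨x, hx⟩ : ∃ x : ℝ, x = (C u - C r) / ρ ^ 2 - k * π := ⟨_, rfl⟩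
      have hS2 : (sin ((C u - C r) / ρ ^ 2) * X r 0 + cos ((C u - C r) / ρ ^ 2) * X r 3) ^ 2
          ≤ 2 * x ^ 2 + 2 * X r 3 ^ 2 := by
        have e : (C u - C r) / ρ ^ 2 = x + k * π := by rw [hx]; ring
        rw [e, sin_add_nat_mul_pi, cos_add_nat_mul_pi]
        have h := corot_sq_le_phase hX h0 r x
        have hsgn : ((-1 : ℝ) ^ k) ^ 2 = 1 := by rw [← pow_mul, mul_comm, pow_mul]; simp
        have e' : ((-1 : ℝ) ^ k * sin x * X r 0 + (-1 : ℝ) ^ k * cos x * X r 3) ^ 2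
            = ((-1 : ℝ) ^ k) ^ 2 * (sin x * X r 0 + cos x * X r 3) ^ 2 := by ring
        rw [e', hsgn, one_mul]
        exact h
      -- (c) `|Φ - kπ| ≤ δ + (k c/β' + ξ)`
      obtain ⟨hu0, hu1⟩ := hrem u hu
      have hxabs : x ^ 2 ≤ 3 * δ ^ 2 + 3 * (k * X u 2 / β') ^ 2 + 3 * ξ ^ 2 := by
        have hpin' := abs_le.1 hpin
        have hxlo : -(δ + (k * X u 2 / β' + ξ)) ≤ x := by rw [hx]; linarith only [hpin'.1, hu1]
        have hxhi : x ≤ δ := by rw [hx]; linarith only [hpin'.2, hu0]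
        have hq : 0 ≤ k * X u 2 / β' := div_nonneg (mul_nonneg k.cast_nonneg hcu) hβ.le
        nlinarith only [hxlo, hxhi, hq, hξ0, sq_nonneg (δ - k * X u 2 / β'),
          sq_nonneg (δ - ξ), sq_nonneg (k * X u 2 / β' - ξ)]
      -- (d) exponential decay `μβ'c² ≤ σc - cc'` and `σc ≤ 2σε`
      have hdecay : μ * β' * (X u 2 * X u 2) ≤ 2 * σ * ε - X u 2 * c' := by
        rw [hc', ← hσ, ← hμ]
        have h1 : σ * X u 0 ^ 2 ≤ σ * 1 := mul_le_mul_of_nonneg_left ha hσ0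
        have h1' := mul_le_mul_of_nonneg_left h1 hcu
        have h1'' : X u 2 * (σ * 1) ≤ 2 * ε * σ :=
          by nlinarith only [hc2 u hu, hσ0]
        have h2 : X u 1 * X u 2 ≤ -β' * X u 2 := mul_le_mul_of_nonneg_right (hb u hu) hcu
        have h3 := mul_le_mul_of_nonneg_left h2 (mul_nonneg hμ0.le hcu)
        nlinarith only [h1', h1'', h3]
      -- (e) `K·(k c/β')² ≤ κ μβ' c²`
      have hcore : K * (k * X u 2 / β') ^ 2 = κ * (μ * β' * (X u 2 * X u 2)) := by
        rw [hκ, hμ]; field_simp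
      have hcore' := mul_le_mul_of_nonneg_left hdecay hκ0
      rw [← hcore] at hcore'
      rw [hm]
      have e2 : 3 * κ * (c' * X u 2 + X u 2 * c') = 6 * (κ * (X u 2 * c')) := by ring
      rw [e2]
      nlinarith only [hd2, hS2, hxabs, hcore', hK])
  have h := hanti (left_mem_Icc.2 htT) (right_mem_Icc.2 htT) htT
  dsimp only at h
  have hcT := hc0 T' (right_mem_Icc.2 htT)
  have e : m * T' = m * t₂ + m * (T' - t₂) := by ring
  rw [sq (X t₂ 2), ← hm]
  linarith only [h, e, mul_nonneg hκ0 (mul_nonneg hcT hcT)]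

end Summit.NavierStokesRegularity.FluidComputer.GateBudget
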